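import Literature.AnabelianGeometry.SemiGraphs.TemperedCoverings
import Literature.AlgebraicGeometry.Frobenioids.QuasiTemperoidConnected
import HarnessLib

/-!
# [SemiAnbd] Def. 3.5 (ii): morphisms of `B^cov(G)` versus connected components and splittings (G10 brick B0, part 2a)

Mochizuki, *Semi-graphs of anabelioids*, Publ. RIMS **42** (2006) 221–322, §3, Definition 3.5
(ii), manuscript p. 37 [cite: MochizukiSemiAnbd2006, Def 3.5(ii) p.37], with the author's correction
[IUTchI] Rmk. 2.5.3 (v): temperedness of a covering `G' → G` is tested on each connected component
of `G'`, through finite étale coverings splitting that component.  In the typed form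
(`TemperedCoverings.lean`, seat abc-iut-L3-t2: `CovObj.Point`, `CovObj.Adj`, `CovObj.SameComponent`,
`CovObj.SplitsAt`, `CovObj.IsTempered`) the components are the classes of the equivalence relation
generated by "same orbit in a fibre" and "glued along a branch".  Proof-only companion (no
definitions) recording how MORPHISMS of `B^cov(G)` interact with these notions — the elementary
covering-space facts used to show that `B^temp(G) ⊆ B^cov(G)` is closed under the temperoid
operations (sibling file):

* `CovObj.adj_map`, `CovObj.sameComponent_map` — a morphism `f : S → T` maps adjacent points to
  adjacent points (equivariance; compatibility with the gluings), hence components into components;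
* `CovObj.exists_preimage_of_sameComponent` — the image of a connected component is a whole
  connected component (the gluings are isomorphisms, so edge points over an image vertex point lift);
* `CovObj.splitsAt_map` — if a finite covering `F` splits `S` at `q`, it splits `T` at `f q`.

The map on points induced by `f` is written out as
`Sum.map (Sigma.map id fun v x => (f.fV v).hom.hom x) (Sigma.map id fun e x => (f.fE e).hom.hom x)`.
abc-iut G10 ladder infrastructure (brick B0, L3-lead 20:21:29Z).  Plain bookkeeping; no statement of
the paper is strengthened.
-/

open CategoryTheory Topology

namespace Literature.AnabelianGeometry.SemiGraphs

namespace ProfiniteSemiGraph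

open Literature.AlgebraicGeometry.Frobenioids.QuasiTemperoid.BTempConnected (hom_ρ ρ_inv_apply
  ρ_apply_inv)

universe u

variable {𝒢 : ProfiniteSemiGraph.{u}}

namespace CovObj

variable {S T : CovObj 𝒢} (f : S ⟶ T)

/-! ### The map on points and the gluings -/

/-- Compatibility of a morphism with the gluings, on points: `glue_T (f_e x) = f_v (glue_S x)`.
[cite: MochizukiSemiAnbd2006, §3 p.36] -/
theorem glue_hom_apply (b : 𝒢.graph.Branch) (v : 𝒢.graph.Vertex) (h : 𝒢.graph.abuts b = some v)
    (x : (S.SE (𝒢.graph.edgeOf b)).obj.V) :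
    ((T.glue b v h).hom.hom.hom ((f.fE (𝒢.graph.edgeOf b)).hom.hom x) : (T.SV v).obj.V) =
      (f.fV v).hom.hom ((S.glue b v h).hom.hom.hom x) :=
  congrArg (fun k : S.SE (𝒢.graph.edgeOf b) ⟶ (BTemp.res (𝒢.brHom b v h)).obj (T.SV v) =>
    (k.hom.hom x : (T.SV v).obj.V)) (f.comm b v h)

/-- `glue.inv (glue.hom x) = x` on points. [cite: MochizukiSemiAnbd2006, §3 p.36] -/
theorem glue_inv_hom_apply (b : 𝒢.graph.Branch) (v : 𝒢.graph.Vertex)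
    (h : 𝒢.graph.abuts b = some v) (x : (S.SE (𝒢.graph.edgeOf b)).obj.V) :
    ((S.glue b v h).inv.hom.hom ((S.glue b v h).hom.hom.hom x) : (S.SE (𝒢.graph.edgeOf b)).obj.V) =
      x :=
  congrArg (fun k : S.SE (𝒢.graph.edgeOf b) ⟶ S.SE (𝒢.graph.edgeOf b) =>
    (k.hom.hom x : (S.SE (𝒢.graph.edgeOf b)).obj.V)) (S.glue b v h).hom_inv_id

/-- `glue.hom (glue.inv y) = y` on points. [cite: MochizukiSemiAnbd2006, §3 p.36] -/
theorem glue_hom_inv_apply (b : 𝒢.graph.Branch) (v : 𝒢.graph.Vertex)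
    (h : 𝒢.graph.abuts b = some v) (y : (S.SV v).obj.V) :
    ((S.glue b v h).hom.hom.hom ((S.glue b v h).inv.hom.hom y) : (S.SV v).obj.V) = y :=
  congrArg (fun k : (BTemp.res (𝒢.brHom b v h)).obj (S.SV v) ⟶
      (BTemp.res (𝒢.brHom b v h)).obj (S.SV v) => (k.hom.hom y : (S.SV v).obj.V))
    (S.glue b v h).inv_hom_id

/-- The gluing of `S` is injective on points. [cite: MochizukiSemiAnbd2006, §3 p.36] -/
theorem glue_hom_injective (b : 𝒢.graph.Branch) (v : 𝒢.graph.Vertex)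
    (h : 𝒢.graph.abuts b = some v) :
    Function.Injective fun x : (S.SE (𝒢.graph.edgeOf b)).obj.V =>
      ((S.glue b v h).hom.hom.hom x : (S.SV v).obj.V) := fun x y hxy => by
  have := congrArg (fun z : (S.SV v).obj.V =>
    ((S.glue b v h).inv.hom.hom z : (S.SE (𝒢.graph.edgeOf b)).obj.V)) hxy
  simpa only [glue_inv_hom_apply] using this

/-! ### Morphisms preserve adjacency and components -/

/-- A morphism of `B^cov(G)` maps adjacent points to adjacent points.
[cite: MochizukiSemiAnbd2006, Def 3.5(ii) p.37] -/
theorem adj_map {p q : S.Point} (hpq : S.Adj p q) :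
    T.Adj (Sum.map (Sigma.map id fun v x => (f.fV v).hom.hom x)
        (Sigma.map id fun e x => (f.fE e).hom.hom x) p)
      (Sum.map (Sigma.map id fun v x => (f.fV v).hom.hom x)
        (Sigma.map id fun e x => (f.fE e).hom.hom x) q) := by
  cases hpq with
  | vertex v g x =>
    change T.Adj (Sum.inl ⟨v, (f.fV v).hom.hom x⟩) (Sum.inl ⟨v, (f.fV v).hom.hom ((S.SV v).obj.ρ g x)⟩)
    rw [hom_ρ]
    exact Adj.vertex v g _
  | edge e g x =>
    change T.Adj (Sum.inr ⟨e, (f.fE e).hom.hom x⟩) (Sum.inr ⟨e, (f.fE e).hom.hom ((S.SE e).obj.ρ g x)⟩)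
    rw [hom_ρ]
    exact Adj.edge e g _
  | glue b v h x =>
    change T.Adj (Sum.inr ⟨𝒢.graph.edgeOf b, (f.fE (𝒢.graph.edgeOf b)).hom.hom x⟩)
      (Sum.inl ⟨v, (f.fV v).hom.hom ((S.glue b v h).hom.hom.hom x)⟩)
    rw [← glue_hom_apply]
    exact Adj.glue b v h _

/-- A morphism of `B^cov(G)` maps connected components into connected components.
[cite: MochizukiSemiAnbd2006, Def 3.5(ii) p.37] -/
theorem sameComponent_map {p q : S.Point} (hpq : S.SameComponent p q) :
    T.SameComponent (Sum.map (Sigma.map id fun v x => (f.fV v).hom.hom x)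
        (Sigma.map id fun e x => (f.fE e).hom.hom x) p)
      (Sum.map (Sigma.map id fun v x => (f.fV v).hom.hom x)
        (Sigma.map id fun e x => (f.fE e).hom.hom x) q) := by
  induction hpq with
  | rel a b hab => exact Relation.EqvGen.rel _ _ (adj_map f hab)
  | refl a => exact Relation.EqvGen.refl _
  | symm a b _ ih => exact Relation.EqvGen.symm _ _ ih
  | trans a b c _ _ ih₁ ih₂ => exact Relation.EqvGen.trans _ _ _ ih₁ ih₂

/-- **The image of a connected component is a whole connected component**: if `q` lies in the
component of `f p'`, then `q = f q'` for some `q'` in the component of `p'` (every orbit move and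
every gluing move in `T` starting at an image point lifts to `S`, the gluings being isomorphisms).
[cite: MochizukiSemiAnbd2006, Def 3.5(ii) p.37] -/
theorem exists_preimage_of_sameComponent (p' : S.Point) (q : T.Point)
    (hq : T.SameComponent (Sum.map (Sigma.map id fun v x => (f.fV v).hom.hom x)
        (Sigma.map id fun e x => (f.fE e).hom.hom x) p') q) :
    ∃ q' : S.Point, S.SameComponent p' q' ∧
      Sum.map (Sigma.map id fun v x => (f.fV v).hom.hom x)
        (Sigma.map id fun e x => (f.fE e).hom.hom x) q' = q := by
  -- the predicate "is the image of a point in the component of `p'`" is invariant under adjacency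
  let pm : S.Point → T.Point := Sum.map (Sigma.map id fun v x => (f.fV v).hom.hom x)
    (Sigma.map id fun e x => (f.fE e).hom.hom x)
  let P : T.Point → Prop := fun a => ∃ a' : S.Point, S.SameComponent p' a' ∧ pm a' = a
  have hPm : ∀ a' : S.Point, S.SameComponent p' a' → P (pm a') := fun a' h => ⟨a', h, rfl⟩
  have step : ∀ {a' : S.Point} {b' : S.Point}, S.SameComponent p' a' → S.Adj a' b' →
      S.SameComponent p' b' := fun h hab =>
    Relation.EqvGen.trans _ _ _ h (Relation.EqvGen.rel _ _ hab)
  have step' : ∀ {a' : S.Point} {b' : S.Point}, S.SameComponent p' a' → S.Adj b' a' →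
      S.SameComponent p' b' := fun h hab =>
    Relation.EqvGen.trans _ _ _ h (Relation.EqvGen.symm _ _ (Relation.EqvGen.rel _ _ hab))
  have hinv : ∀ a b : T.Point, T.Adj a b → (P a ↔ P b) := by
    intro a b hab
    cases hab with
    | vertex v g y =>
      constructor
      · rintro ⟨a', ha', hpa⟩
        rcases a' with ⟨w, x⟩ | ⟨e, x⟩
        · obtain ⟨hwv, hx⟩ := Sigma.mk.inj_iff.mp (Sum.inl.inj hpa)
          subst hwv
          have hx' : ((f.fV w).hom.hom x : (T.SV w).obj.V) = y := eq_of_heq hx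
          refine ⟨Sum.inl ⟨w, (S.SV w).obj.ρ g x⟩, step ha' (Adj.vertex w g x), ?_⟩
          change (Sum.inl ⟨w, (f.fV w).hom.hom ((S.SV w).obj.ρ g x)⟩ : T.Point) =
            Sum.inl ⟨w, (T.SV w).obj.ρ g y⟩
          rw [hom_ρ, hx']
        · exact absurd hpa (by simp [pm])
      · rintro ⟨b', hb', hpb⟩
        rcases b' with ⟨w, x⟩ | ⟨e, x⟩
        · obtain ⟨hwv, hx⟩ := Sigma.mk.inj_iff.mp (Sum.inl.inj hpb)
          subst hwv
          have hx' : ((f.fV w).hom.hom x : (T.SV w).obj.V) = (T.SV w).obj.ρ g y := eq_of_heq hx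
          refine ⟨Sum.inl ⟨w, (S.SV w).obj.ρ g⁻¹ x⟩, step hb' (Adj.vertex w g⁻¹ x), ?_⟩
          change (Sum.inl ⟨w, (f.fV w).hom.hom ((S.SV w).obj.ρ g⁻¹ x)⟩ : T.Point) = Sum.inl ⟨w, y⟩
          rw [hom_ρ, hx', ρ_inv_apply]
        · exact absurd hpb (by simp [pm])
    | edge e g y =>
      constructor
      · rintro ⟨a', ha', hpa⟩
        rcases a' with ⟨w, x⟩ | ⟨e', x⟩
        · exact absurd hpa (by simp [pm])
        · obtain ⟨hee, hx⟩ := Sigma.mk.inj_iff.mp (Sum.inr.inj hpa)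
          subst hee
          have hx' : ((f.fE e').hom.hom x : (T.SE e').obj.V) = y := eq_of_heq hx
          refine ⟨Sum.inr ⟨e', (S.SE e').obj.ρ g x⟩, step ha' (Adj.edge e' g x), ?_⟩
          change (Sum.inr ⟨e', (f.fE e').hom.hom ((S.SE e').obj.ρ g x)⟩ : T.Point) =
            Sum.inr ⟨e', (T.SE e').obj.ρ g y⟩
          rw [hom_ρ, hx']
      · rintro ⟨b', hb', hpb⟩
        rcases b' with ⟨w, x⟩ | ⟨e', x⟩
        · exact absurd hpb (by simp [pm])
        · obtain ⟨hee, hx⟩ := Sigma.mk.inj_iff.mp (Sum.inr.inj hpb)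
          subst hee
          have hx' : ((f.fE e').hom.hom x : (T.SE e').obj.V) = (T.SE e').obj.ρ g y := eq_of_heq hx
          refine ⟨Sum.inr ⟨e', (S.SE e').obj.ρ g⁻¹ x⟩, step hb' (Adj.edge e' g⁻¹ x), ?_⟩
          change (Sum.inr ⟨e', (f.fE e').hom.hom ((S.SE e').obj.ρ g⁻¹ x)⟩ : T.Point) = Sum.inr ⟨e', y⟩
          rw [hom_ρ, hx', ρ_inv_apply]
    | glue b v h y =>
      constructor
      · rintro ⟨a', ha', hpa⟩
        rcases a' with ⟨w, x⟩ | ⟨e', x⟩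
        · exact absurd hpa (by simp [pm])
        · obtain ⟨hee, hx⟩ := Sigma.mk.inj_iff.mp (Sum.inr.inj hpa)
          subst hee
          have hx' : ((f.fE (𝒢.graph.edgeOf b)).hom.hom x : (T.SE (𝒢.graph.edgeOf b)).obj.V) = y :=
            eq_of_heq hx
          refine ⟨Sum.inl ⟨v, (S.glue b v h).hom.hom.hom x⟩, step ha' (Adj.glue b v h x), ?_⟩
          change (Sum.inl ⟨v, (f.fV v).hom.hom ((S.glue b v h).hom.hom.hom x)⟩ : T.Point) =
            Sum.inl ⟨v, (T.glue b v h).hom.hom.hom y⟩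
          rw [← glue_hom_apply, hx']
      · rintro ⟨b', hb', hpb⟩
        rcases b' with ⟨w, x⟩ | ⟨e', x⟩
        · obtain ⟨hwv, hx⟩ := Sigma.mk.inj_iff.mp (Sum.inl.inj hpb)
          subst hwv
          have hx' : ((f.fV w).hom.hom x : (T.SV w).obj.V) = (T.glue b w h).hom.hom.hom y :=
            eq_of_heq hx
          refine ⟨Sum.inr ⟨𝒢.graph.edgeOf b, (S.glue b w h).inv.hom.hom x⟩, step' hb' ?_, ?_⟩
          · have := Adj.glue (S := S) b w h ((S.glue b w h).inv.hom.hom x)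
            rwa [glue_hom_inv_apply] at this
          · change (Sum.inr ⟨𝒢.graph.edgeOf b,
                (f.fE (𝒢.graph.edgeOf b)).hom.hom ((S.glue b w h).inv.hom.hom x)⟩ : T.Point) =
              Sum.inr ⟨𝒢.graph.edgeOf b, y⟩
            have hy : ((f.fE (𝒢.graph.edgeOf b)).hom.hom ((S.glue b w h).inv.hom.hom x) :
                (T.SE (𝒢.graph.edgeOf b)).obj.V) = y := by
              apply glue_hom_injective (S := T) b w h
              change ((T.glue b w h).hom.hom.hom _ : (T.SV w).obj.V) = (T.glue b w h).hom.hom.hom y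
              rw [glue_hom_apply, glue_hom_inv_apply, hx']
            rw [hy]
        · exact absurd hpb (by simp [pm])
  -- propagate along the equivalence relation
  have key : ∀ a b : T.Point, T.SameComponent a b → (P a ↔ P b) := by
    intro a b hab
    induction hab with
    | rel a b hab => exact hinv a b hab
    | refl a => exact Iff.rfl
    | symm a b _ ih => exact ih.symm
    | trans a b c _ _ ih₁ ih₂ => exact ih₁.trans ih₂
  exact (key _ _ hq).mp (hPm p' (Relation.EqvGen.refl _))

/-! ### Splittings push forward -/

/-- If a finite covering `F` splits `S` at `q`, it splits `T` at the image of `q` under any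
morphism `S → T` (stabilisers fixing `q` fix its image). [cite: MochizukiSemiAnbd2006, Def 3.5(ii) p.37] -/
theorem splitsAt_map (F : CovObj 𝒢) {q : S.Point} (hq : F.SplitsAt S q) :
    F.SplitsAt T (Sum.map (Sigma.map id fun v x => (f.fV v).hom.hom x)
      (Sigma.map id fun e x => (f.fE e).hom.hom x) q) := by
  rcases q with ⟨v, s⟩ | ⟨e, s⟩
  · change ∀ (x : (F.SV v).obj.V) (g : 𝒢.Gv v), (F.SV v).obj.ρ g x = x →
      (T.SV v).obj.ρ g ((f.fV v).hom.hom s) = (f.fV v).hom.hom s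
    intro x g hx
    rw [← hom_ρ, hq x g hx]
  · change ∀ (x : (F.SE e).obj.V) (g : 𝒢.Ge e), (F.SE e).obj.ρ g x = x →
      (T.SE e).obj.ρ g ((f.fE e).hom.hom s) = (f.fE e).hom.hom s
    intro x g hx
    rw [← hom_ρ, hq x g hx]

end CovObj

end ProfiniteSemiGraph

end Literature.AnabelianGeometry.SemiGraphs
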